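import Mathlib.Tactic
import Mathlib.Data.Int.GCD
import Mathlib.Algebra.Group.Subgroup.ZPowers.Basic
import HarnessLib

/-!
# Hallgren 2005 / class numbers under GRH — step Q1a (lattice part): a two-element generating set
# of a subgroup of `ℤ²` from finitely many generators (Hermite normal form by Bezout)

Topic `Literature/Computability/Cryptography`; proof companion of `HallgrenClassGroup.lean`
(named fact `Hallgren2005_classNumber_qsolvable_of_GRH`). Real definitions (with bodies) and
theorems; no named fact.

The composition of two forms in the class-number algorithm multiplies the two form ideals
`𝔞_i = ℤ a_i ⊕ ℤ η_i` of `𝓞_K = ℤ ⊕ ℤ ω`: the product is the `ℤ`-span of the four products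
`a₁a₂, a₁η₂, a₂η₁, η₁η₂`, a rank-two lattice in `ℤ ⊕ ℤω ≅ ℤ²` given by four generators, and the
composed form is read off its Hermite normal form `ℤ (g', 0) ⊕ ℤ (x, d)`. This file is the generic
integer computation: from a list `L` of vectors of `ℤ²`,

* `gcdVec L` — a `ℤ`-combination `w` of `L` whose second coordinate is `d = gcd` of the second
  coordinates (`gcdVec_mem_closure`, `gcdVec_snd_dvd`, `gcdVec_snd_nonneg`);
* `axisPart L` — the generators `v − (v₂/d) w` on the axis `ℤ × {0}`, and `axisGcd L = g'`, the gcd of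
  their first coordinates (again by `gcdVec`, on swapped vectors);
* `closure_eq_closure_pair` — **`⟨L⟩ = ⟨(g', 0), w⟩`**.

All gcds are Mathlib's `Int.gcd` with Bezout coefficients `Int.gcdA`, `Int.gcdB`
(`Int.gcd_eq_gcd_ab`), so the definitions ARE the algorithm (a left fold of extended Euclid).

## References

* H. Cohen, *A Course in Computational Algebraic Number Theory*, GTM 138, §2.4.2 (Hermite normal
  form), §5.4.2 (composition as ideal multiplication) [folklore].
* A. M. Childs, W. van Dam, Rev. Mod. Phys. 82 (2010), §5.7 [ChildsVandam2010].
-/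

namespace Literature.Computability.Cryptography.Hallgren2005

namespace LatticeHNF


/-! ### A combination with second coordinate the gcd of the second coordinates -/

/-- **Bezout fold**: a `ℤ`-combination of the vectors of `L` whose second coordinate is the gcd of
their second coordinates (for `v :: vs`: with `w = gcdVec vs`, `g = gcd(v₂, w₂) = v₂ s + w₂ t`, return
`s v + t w`). [folklore] -/
def gcdVec : List (ℤ × ℤ) → ℤ × ℤ
  | [] => (0, 0)
  | v :: vs => Int.gcdA v.2 (gcdVec vs).2 • v + Int.gcdB v.2 (gcdVec vs).2 • (gcdVec vs)

/-- The second coordinate of `gcdVec (v :: vs)` is `gcd(v₂, (gcdVec vs)₂)`. [folklore] -/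
theorem gcdVec_cons_snd (v : ℤ × ℤ) (vs : List (ℤ × ℤ)) :
    (gcdVec (v :: vs)).2 = (Int.gcd v.2 (gcdVec vs).2 : ℤ) := by
  rw [gcdVec, Prod.snd_add, Prod.smul_snd, Prod.smul_snd, smul_eq_mul, smul_eq_mul, Int.gcd_eq_gcd_ab]
  ring

/-- `gcdVec L` lies in the subgroup generated by `L`. [folklore] -/
theorem gcdVec_mem_closure : ∀ L : List (ℤ × ℤ), gcdVec L ∈ AddSubgroup.closure {v | v ∈ L}
  | [] => by rw [gcdVec]; exact zero_mem _
  | v :: vs => by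
    rw [gcdVec]
    have hv : v ∈ AddSubgroup.closure {u | u ∈ v :: vs} := AddSubgroup.subset_closure (by simp)
    have hw : gcdVec vs ∈ AddSubgroup.closure {u | u ∈ v :: vs} :=
      AddSubgroup.closure_mono (fun u hu => by simp only [Set.mem_setOf_eq, List.mem_cons] at hu ⊢; exact Or.inr hu)
        (gcdVec_mem_closure vs)
    exact add_mem (zsmul_mem hv _) (zsmul_mem hw _)

/-- The second coordinate of `gcdVec L` divides every second coordinate in `L`. [folklore] -/
theorem gcdVec_snd_dvd : ∀ (L : List (ℤ × ℤ)), ∀ v ∈ L, (gcdVec L).2 ∣ v.2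
  | [], v, hv => by simp at hv
  | u :: us, v, hv => by
    rw [gcdVec_cons_snd]
    rcases List.mem_cons.mp hv with rfl | hv
    · exact Int.gcd_dvd_left _ _
    · exact (Int.gcd_dvd_right _ _).trans (gcdVec_snd_dvd us v hv)

/-- The second coordinate of `gcdVec L` is non-negative. [folklore] -/
theorem gcdVec_snd_nonneg : ∀ L : List (ℤ × ℤ), 0 ≤ (gcdVec L).2
  | [] => by simp [gcdVec]
  | v :: vs => by rw [gcdVec_cons_snd]; exact Int.natCast_nonneg _

/-- Every second coordinate in `⟨L⟩` is divisible by `(gcdVec L)₂`. [folklore] -/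
theorem gcdVec_snd_dvd_of_mem_closure (L : List (ℤ × ℤ)) {v : ℤ × ℤ} (hv : v ∈ AddSubgroup.closure {u | u ∈ L}) :
    (gcdVec L).2 ∣ v.2 := by
  induction hv using AddSubgroup.closure_induction with
  | mem u hu => exact gcdVec_snd_dvd L u hu
  | zero => exact dvd_zero _
  | add x y _ _ hx hy => rw [Prod.snd_add]; exact dvd_add hx hy
  | neg x _ hx => rw [Prod.snd_neg]; exact (dvd_neg).mpr hx

/-! ### The part on the axis `ℤ × {0}` -/

/-- The generators moved to the axis: `v − (v₂ / d) · w`, `w = gcdVec L`, `d = w₂`. [folklore] -/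
def axisPart (L : List (ℤ × ℤ)) : List (ℤ × ℤ) :=
  L.map fun v => v - (v.2 / (gcdVec L).2) • gcdVec L

/-- The vectors of `axisPart L` have second coordinate `0`. [folklore] -/
theorem axisPart_snd_eq_zero (L : List (ℤ × ℤ)) : ∀ u ∈ axisPart L, u.2 = 0 := by
  intro u hu
  obtain ⟨v, hv, rfl⟩ := List.mem_map.mp hu
  rw [Prod.snd_sub, Prod.smul_snd, smul_eq_mul, Int.ediv_mul_cancel (gcdVec_snd_dvd L v hv), sub_self]

/-- The vectors of `axisPart L` lie in `⟨L⟩`. [folklore] -/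
theorem axisPart_mem_closure (L : List (ℤ × ℤ)) : ∀ u ∈ axisPart L, u ∈ AddSubgroup.closure {v | v ∈ L} := by
  intro u hu
  obtain ⟨v, hv, rfl⟩ := List.mem_map.mp hu
  exact sub_mem (AddSubgroup.subset_closure hv) (zsmul_mem (gcdVec_mem_closure L) _)

/-- **The axis gcd** `g'`: the gcd of the first coordinates of `axisPart L` (computed by `gcdVec` on
the swapped vectors; non-negative). [folklore] -/
def axisGcd (L : List (ℤ × ℤ)) : ℤ := (gcdVec ((axisPart L).map Prod.swap)).2

/-- `(g', 0) ∈ ⟨L⟩`. [folklore] -/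
theorem axisGcd_mem_closure (L : List (ℤ × ℤ)) : ((axisGcd L, 0) : ℤ × ℤ) ∈ AddSubgroup.closure {v | v ∈ L} := by
  -- the swap of `gcdVec (swapped axis parts)` is a combination of axis parts
  have hmem := gcdVec_mem_closure ((axisPart L).map Prod.swap)
  -- transport along the swap isomorphism
  have hswap : ∀ {S : Set (ℤ × ℤ)} {x : ℤ × ℤ}, x ∈ AddSubgroup.closure (Prod.swap '' S) → x.swap ∈ AddSubgroup.closure S := by
    intro S x hx
    induction hx using AddSubgroup.closure_induction with
    | mem u hu =>
      obtain ⟨y, hy, rfl⟩ := hu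
      rw [Prod.swap_swap]; exact AddSubgroup.subset_closure hy
    | zero => exact zero_mem _
    | add x y _ _ hx hy => rw [Prod.swap_add]; exact add_mem hx hy
    | neg x _ hx => rw [Prod.swap_neg]; exact neg_mem hx
  have hset : {v | v ∈ (axisPart L).map Prod.swap} = Prod.swap '' {u | u ∈ axisPart L} := by
    ext x
    simp only [Set.mem_setOf_eq, List.mem_map, Set.mem_image]
  rw [hset] at hmem
  have h1 := hswap hmem
  -- its second coordinate (= first of the swapped) is `0`, its first is `axisGcd L`
  have hfst : (gcdVec ((axisPart L).map Prod.swap)).swap = (axisGcd L, 0) := by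
    ext
    · rfl
    · -- the first coordinate of `gcdVec` of vectors with first coordinate `0` is `0`
      have hzero : ∀ (M : List (ℤ × ℤ)), (∀ u ∈ M, u.1 = 0) → (gcdVec M).1 = 0 := by
        intro M hM
        induction M with
        | nil => simp [gcdVec]
        | cons u us ih =>
          rw [gcdVec, Prod.fst_add, Prod.smul_fst, Prod.smul_fst, smul_eq_mul, smul_eq_mul,
            hM u (by simp), ih (fun u' hu' => hM u' (by simp [hu'])), mul_zero, mul_zero, add_zero]
      rw [Prod.snd_swap]
      refine hzero _ fun u hu => ?_
      obtain ⟨y, hy, rfl⟩ := List.mem_map.mp hu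
      rw [Prod.fst_swap]
      exact axisPart_snd_eq_zero L y hy
  rw [hfst] at h1
  exact (AddSubgroup.closure_le _).mpr (fun u hu => axisPart_mem_closure L u hu) h1

/-- `g'` divides the first coordinate of every axis part. [folklore] -/
theorem axisGcd_dvd (L : List (ℤ × ℤ)) : ∀ u ∈ axisPart L, axisGcd L ∣ u.1 := by
  intro u hu
  have := gcdVec_snd_dvd ((axisPart L).map Prod.swap) u.swap (List.mem_map.mpr ⟨u, hu, rfl⟩)
  rwa [Prod.snd_swap] at this

/-- `g' ≥ 0`. [folklore] -/
theorem axisGcd_nonneg (L : List (ℤ × ℤ)) : 0 ≤ axisGcd L := gcdVec_snd_nonneg _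

/-! ### The two-element generating set -/

/-- **`⟨L⟩ = ⟨(g', 0), w⟩`** with `w = gcdVec L` and `g' = axisGcd L`: every `v ∈ L` is
`(v − (v₂/d) w) + (v₂/d) w` with the first summand a multiple of `(g', 0)`; conversely both
generators lie in `⟨L⟩`. (Hermite normal form of the lattice generated by `L`.) [folklore] -/
theorem closure_eq_closure_pair (L : List (ℤ × ℤ)) :
    AddSubgroup.closure {v | v ∈ L} = AddSubgroup.closure {((axisGcd L, 0) : ℤ × ℤ), gcdVec L} := by
  apply le_antisymm
  · refine (AddSubgroup.closure_le _).mpr fun v hv => ?_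
    have hg : ((axisGcd L, 0) : ℤ × ℤ) ∈ AddSubgroup.closure {((axisGcd L, 0) : ℤ × ℤ), gcdVec L} :=
      AddSubgroup.subset_closure (Set.mem_insert _ _)
    have hw : gcdVec L ∈ AddSubgroup.closure {((axisGcd L, 0) : ℤ × ℤ), gcdVec L} :=
      AddSubgroup.subset_closure (Set.mem_insert_of_mem _ (Set.mem_singleton _))
    set u : ℤ × ℤ := v - (v.2 / (gcdVec L).2) • gcdVec L with hu
    have huL : u ∈ axisPart L := List.mem_map.mpr ⟨v, hv, rfl⟩
    have hu0 : u.2 = 0 := axisPart_snd_eq_zero L u huL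
    obtain ⟨c, hc⟩ := axisGcd_dvd L u huL
    have hueq : u = c • ((axisGcd L, 0) : ℤ × ℤ) := by
      ext
      · rw [Prod.smul_fst, smul_eq_mul, mul_comm]; exact hc
      · rw [hu0, Prod.smul_snd, smul_eq_mul, mul_zero]
    have hv_eq : v = u + (v.2 / (gcdVec L).2) • gcdVec L := by rw [hu]; abel
    rw [hv_eq, hueq]
    exact add_mem (zsmul_mem hg _) (zsmul_mem hw _)
  · refine (AddSubgroup.closure_le _).mpr ?_
    rintro v (rfl | rfl)
    · exact axisGcd_mem_closure L
    · exact gcdVec_mem_closure L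

/-- Every element of `⟨L⟩` is `a (g', 0) + c w` — coordinates along the Hermite basis. [folklore] -/
theorem exists_eq_of_mem_closure (L : List (ℤ × ℤ)) {v : ℤ × ℤ} (hv : v ∈ AddSubgroup.closure {u | u ∈ L}) :
    ∃ a c : ℤ, v = a • ((axisGcd L, 0) : ℤ × ℤ) + c • gcdVec L := by
  rw [closure_eq_closure_pair] at hv
  induction hv using AddSubgroup.closure_induction with
  | mem u hu =>
    rcases hu with rfl | rfl
    · exact ⟨1, 0, by simp⟩
    · exact ⟨0, 1, by simp⟩
  | zero => exact ⟨0, 0, by simp⟩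
  | add x y _ _ hx hy =>
    obtain ⟨a, c, rfl⟩ := hx
    obtain ⟨a', c', rfl⟩ := hy
    exact ⟨a + a', c + c', by rw [add_smul, add_smul]; abel⟩
  | neg x _ hx =>
    obtain ⟨a, c, rfl⟩ := hx
    exact ⟨-a, -c, by rw [neg_smul, neg_smul, neg_add]⟩

end LatticeHNF

end Literature.Computability.Cryptography.Hallgren2005
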